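import Summits.QuantumFields.YangMills.Theses.ConvexGribovBody
import Literature.MathematicalPhysics.QuantumFieldTheory.ConstructiveQFTWave0OddRPProofs
import Literature.MathematicalPhysics.QuantumFieldTheory.LatticeGaugeProofs

/-!
# Stub `stub_rpHankel` of the crux `BrascampLiebVacuum` (line `SketchIdeator2`)

Reflection positivity on the odd torus in Hankel form. For Wilson's lattice measure
`μ = wilsonMeasure r.ρ β` on the torus `(ℤ/L)⁴`, `L = 2S+1`, and a link-Lipschitz function `f`
of the time-zero spatial links, the time autocovariance `G(u) = E_μ (f - m)(f ∘ τ_u - m)`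
(`τ_u` = translation by `u` units of Euclidean time, `m = E_μ f`) satisfies

* `G(u) = G(L - u)` for `u ≤ L` (time-translation invariance of `μ`,
  `wilsonMeasure_map_torusConfigShift`);
* the two Hankel forms `Σ_{i,j ≤ S} aᵢ aⱼ G(i+j)` and `Σ_{i,j ≤ S} aᵢ aⱼ G(i+j+1)` are
  non-negative (Osterwalder–Seiler positivity for the reflection `t ↦ 1 - t` of the odd torus,
  `wilsonExpectation_oddReflectionPositive`, applied to `Σ aᵢ (f ∘ τ_{S+1-i} - m)` and to
  `Σ aᵢ (f ∘ τ_{i+1} - m)`);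
* `E_μ (f - f ∘ τ₁)² = 2 G(0) - 2 G(1)`.

The Lipschitz hypothesis is only used to get continuity of `f`, hence (by second countability of
`G`, a closed subgroup of `U(N)` through `r.ρ`) measurability and boundedness.
-/

open scoped BigOperators Topology Matrix ComplexConjugate ComplexOrder
open Filter MeasureTheory
open Literature.MathematicalPhysics.QuantumFieldTheory

noncomputable section

namespace Summit.QuantumFields.YangMills.Theorems.BrascampLiebVacuum

/-! ### Generic measure-theoretic helpers -/

/-- The product of two bounded measurable real functions is integrable against a finite
measure. [folklore] -/
theorem rpHankel_integrable_mul {X : Type*} [MeasurableSpace X] {μ : Measure X}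
    [IsFiniteMeasure μ] {p q : X → ℝ} (hp : Measurable p) (hq : Measurable q) {Cp Cq : ℝ}
    (hpb : ∀ x, |p x| ≤ Cp) (hqb : ∀ x, |q x| ≤ Cq) :
    Integrable (fun x => p x * q x) μ := by
  refine Integrable.of_bound (hp.mul hq).aestronglyMeasurable (Cp * Cq) (ae_of_all _ fun x => ?_)
  rw [Real.norm_eq_abs, abs_mul]
  exact mul_le_mul (hpb x) (hqb x) (abs_nonneg _) ((abs_nonneg _).trans (hpb x))

/-- Expansion of the integral of the product of two finite linear combinations of bounded
measurable functions into the double sum of pair integrals. [folklore] -/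
theorem rpHankel_expand {X : Type*} [MeasurableSpace X] (μ : Measure X) [IsFiniteMeasure μ]
    (n : ℕ) (a : ℕ → ℝ) (p q : ℕ → X → ℝ) (hpm : ∀ i, Measurable (p i))
    (hqm : ∀ i, Measurable (q i)) {C : ℝ} (hpb : ∀ i x, |p i x| ≤ C) (hqb : ∀ i x, |q i x| ≤ C) :
    ∫ x, (∑ i ∈ Finset.range n, a i * p i x) * (∑ j ∈ Finset.range n, a j * q j x) ∂μ =
      ∑ i ∈ Finset.range n, ∑ j ∈ Finset.range n, a i * a j * ∫ x, p i x * q j x ∂μ := by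
  have hterm : ∀ i j, Integrable (fun x => a i * p i x * (a j * q j x)) μ := fun i j =>
    ((rpHankel_integrable_mul (hpm i) (hqm j) (hpb i) (hqb j)).const_mul (a i * a j)).congr
      (ae_of_all _ fun x => by ring)
  simp_rw [Finset.sum_mul_sum]
  rw [integral_finsetSum _ fun i _ => integrable_finsetSum _ fun j _ => hterm i j]
  refine Finset.sum_congr rfl fun i _ => ?_
  rw [integral_finsetSum _ fun j _ => hterm i j]
  refine Finset.sum_congr rfl fun j _ => ?_
  rw [← integral_const_mul]
  exact integral_congr_ae (ae_of_all _ fun x => by ring)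

/-- A continuous real function on a compact space is bounded. [folklore] -/
theorem rpHankel_bounded {Y : Type*} [TopologicalSpace Y] [CompactSpace Y] {f : Y → ℝ}
    (hf : Continuous f) : ∃ C : ℝ, ∀ y, |f y| ≤ C := by
  obtain ⟨C, hC⟩ := isCompact_univ.exists_bound_of_continuousOn hf.continuousOn
  exact ⟨C, fun y => by simpa only [Real.norm_eq_abs] using hC y (Set.mem_univ y)⟩

/-! ### Lattice helpers: time shifts, reflection, translation invariance -/

/-- A link-Lipschitz function (in the matrix entries of a continuous representation) of the
gauge configuration is continuous. [folklore] -/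
theorem rpHankel_continuous {L : ℕ} [NeZero L] {G : Type*} [Group G] [TopologicalSpace G]
    (r : LatticeRep G) {f : GaugeConfig 4 L G → ℝ}
    (hf : ∃ K : ℝ, ∀ U V : GaugeConfig 4 L G,
      |f U - f V| ≤ K * ∑ e, Real.sqrt (∑ a, ∑ b, ‖(r.ρ (U e) - r.ρ (V e)) a b‖ ^ 2)) :
    Continuous f := by
  obtain ⟨K, hK⟩ := hf
  have hρ := r.continuous
  refine continuous_iff_continuousAt.2 fun V => ?_
  have hb : Continuous fun U : GaugeConfig 4 L G =>
      K * ∑ e, Real.sqrt (∑ a, ∑ b, ‖(r.ρ (U e) - r.ρ (V e)) a b‖ ^ 2) := by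
    refine continuous_const.mul (continuous_finsetSum _ fun e _ => ?_)
    refine Real.continuous_sqrt.comp
      (continuous_finsetSum _ fun a _ => continuous_finsetSum _ fun b _ => ?_)
    have h1 : Continuous fun U : GaugeConfig 4 L G => r.ρ (U e) - r.ρ (V e) :=
      (hρ.comp (continuous_apply e)).sub continuous_const
    exact (continuous_norm.comp (h1.matrix_elem a b)).pow 2
  have h0 : K * ∑ e, Real.sqrt (∑ a, ∑ b, ‖(r.ρ (V e) - r.ρ (V e)) a b‖ ^ 2) = 0 := by simp
  refine tendsto_iff_norm_sub_tendsto_zero.2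
    (squeeze_zero (fun U => norm_nonneg _) (fun U => ?_) (h0 ▸ hb.tendsto V))
  rw [Real.norm_eq_abs]
  exact hK U V

/-- The time shift is measurable for the product σ-algebra. [folklore] -/
theorem rpHankel_measurable_shift {L : ℕ} {G : Type*} [MeasurableSpace G]
    (σ : ZMod L → GaugeConfig 4 L G → GaugeConfig 4 L G)
    (hσ : ∀ z U e, σ z U e = U (e.1 + Pi.single 0 z, e.2)) (z : ZMod L) : Measurable (σ z) := by
  refine measurable_pi_lambda _ fun e => ?_
  simp only [hσ]
  exact measurable_pi_apply _

/-- A function of the time-zero spatial links, shifted to the slice `t` and evaluated on the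
reflected configuration `ΘU` (`θ t = 1 - t`), is the function shifted to the slice `1 - t`
evaluated on `U`. [folklore] -/
theorem rpHankel_reflect {L : ℕ} {G : Type*} [Group G] {α : Sort*} (g : GaugeConfig 4 L G → α)
    (hg : ∀ U V : GaugeConfig 4 L G,
      (∀ e : Edge 4 L, e.1 0 = 0 → e.2 ≠ 0 → U e = V e) → g U = g V)
    (σ : ZMod L → GaugeConfig 4 L G → GaugeConfig 4 L G)
    (hσ : ∀ z U e, σ z U e = U (e.1 + Pi.single 0 z, e.2)) (t : ZMod L) (U : GaugeConfig 4 L G) :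
    g (σ t U.timeReflect) = g (σ (1 - t) U) := by
  refine hg _ _ fun e he0 hne => ?_
  have key : Site.timeReflect (e.1 + Pi.single 0 t) = e.1 + Pi.single 0 (1 - t) := by
    funext k
    by_cases hk : k = 0
    · subst hk
      simp [Site.timeReflect, he0]
    · simp [Site.timeReflect, hk]
  rw [hσ, hσ]
  simp only [GaugeConfig.timeReflect, hne, if_false, key]

section Wilson

variable {L : ℕ} [NeZero L] {G : Type*} [Group G] [TopologicalSpace G] [IsTopologicalGroup G]
  [CompactSpace G] [MeasurableSpace G] [BorelSpace G]

/-- Time-translation invariance of Wilson expectations (`wilsonMeasure_map_torusConfigShift`),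
in the form `E_μ (h ∘ τ_z) = E_μ h`. [folklore] -/
theorem rpHankel_integral_shift {N : ℕ} (ρ : G →* Matrix (Fin N) (Fin N) ℂ) (β : ℝ)
    (σ : ZMod L → GaugeConfig 4 L G → GaugeConfig 4 L G)
    (hσ : ∀ z U e, σ z U e = U (e.1 + Pi.single 0 z, e.2)) (z : ZMod L)
    (h : GaugeConfig 4 L G → ℝ) :
    ∫ U, h (σ z U) ∂(wilsonMeasure ρ β) = ∫ U, h U ∂(wilsonMeasure ρ β) := by
  have hfun : σ z = ⇑(torusConfigShift (G := G) (-(Pi.single 0 z : Site 4 L))) := by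
    funext U e
    rw [hσ, torusConfigShift_apply, sub_neg_eq_add]
  conv_rhs => rw [← wilsonMeasure_map_torusConfigShift ρ β (-(Pi.single 0 z : Site 4 L))]
  rw [integral_map_equiv, hfun]

/-- Pair correlations of time shifts only depend on the time difference:
`E_μ (g ∘ τ_z)(g ∘ τ_w) = E_μ g (g ∘ τ_{w-z})`. [folklore] -/
theorem rpHankel_pair {N : ℕ} (ρ : G →* Matrix (Fin N) (Fin N) ℂ) (β : ℝ)
    (σ : ZMod L → GaugeConfig 4 L G → GaugeConfig 4 L G)
    (hσ : ∀ z U e, σ z U e = U (e.1 + Pi.single 0 z, e.2)) (g : GaugeConfig 4 L G → ℝ)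
    (z w : ZMod L) :
    ∫ U, g (σ z U) * g (σ w U) ∂(wilsonMeasure ρ β) =
      ∫ U, g U * g (σ (w - z) U) ∂(wilsonMeasure ρ β) := by
  have hcomp : ∀ U, σ (w - z) (σ z U) = σ w U := fun U => by
    funext e
    simp only [hσ, add_assoc, ← Pi.single_add, sub_add_cancel]
  rw [← rpHankel_integral_shift ρ β σ hσ z (fun U => g U * g (σ (w - z) U))]
  simp_rw [hcomp]

/-- **Reflection positivity in bilinear form.** For `L` odd, `L ≥ 3`, `β ≥ 0`, a bounded
measurable function `g` of the time-zero spatial links and slices `s i ∈ {1, …, L/2 + 1}`,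
`0 ≤ Σ_{i,j<n} aᵢ aⱼ E_μ (g ∘ τ_{1 - s i})(g ∘ τ_{s j})`: this is
`0 ≤ E_μ F(ΘU) F(U)` for `F = Σ aᵢ (g ∘ τ_{s i})`
(`wilsonExpectation_oddReflectionPositive`). [folklore] -/
theorem rpHankel_rp (r : LatticeRep G) {β : ℝ} (hβ : 0 ≤ β) (hL : Odd L) (hL3 : 3 ≤ L)
    {g : GaugeConfig 4 L G → ℝ} (hgm : Measurable g) {Cg : ℝ} (hgb : ∀ U, |g U| ≤ Cg)
    (hg : ∀ U V : GaugeConfig 4 L G,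
      (∀ e : Edge 4 L, e.1 0 = 0 → e.2 ≠ 0 → U e = V e) → g U = g V)
    (σ : ZMod L → GaugeConfig 4 L G → GaugeConfig 4 L G)
    (hσ : ∀ z U e, σ z U e = U (e.1 + Pi.single 0 z, e.2))
    {n : ℕ} {s : ℕ → ZMod L} (hs : ∀ i < n, 1 ≤ (s i).val ∧ (s i).val ≤ L / 2 + 1)
    (a : ℕ → ℝ) :
    0 ≤ ∑ i ∈ Finset.range n, ∑ j ∈ Finset.range n,
      a i * a j * ∫ U, g (σ (1 - s i) U) * g (σ (s j) U) ∂(wilsonMeasure r.ρ β) := by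
  haveI := isProbabilityMeasure_wilsonMeasure (d := 4) (L := L) r.ρ r.continuous β
  have hσm : ∀ x, Measurable fun U : GaugeConfig 4 L G => g (σ x U) := fun x =>
    hgm.comp (rpHankel_measurable_shift σ hσ x)
  -- the positive-time observable
  obtain ⟨F, hF⟩ : ∃ F : GaugeConfig 4 L G → ℝ,
      ∀ V, F V = ∑ i ∈ Finset.range n, a i * g (σ (s i) V) := ⟨_, fun _ => rfl⟩
  have hFeq : F = fun V => ∑ i ∈ Finset.range n, a i * g (σ (s i) V) := funext hF
  have hFm : Measurable F := by
    rw [hFeq]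
    exact Finset.measurable_sum _ fun i _ => (hσm (s i)).const_mul (a i)
  have hFb : ∀ U, ‖(F U : ℂ)‖ ≤ ∑ i ∈ Finset.range n, |a i| * Cg := fun U => by
    rw [Complex.norm_real, Real.norm_eq_abs, hF]
    refine (Finset.abs_sum_le_sum_abs _ _).trans (Finset.sum_le_sum fun i _ => ?_)
    rw [abs_mul]
    exact mul_le_mul_of_nonneg_left (hgb _) (abs_nonneg _)
  have hFdep : DependsOn (fun U => (F U : ℂ))
      ((WilsonOddRP.oPosEdges ∪ WilsonOddRP.oSharedEdges : Finset (Edge 4 L)) :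
        Set (Edge 4 L)) := by
    intro U V hUV
    simp only [hF]
    congr 1
    refine Finset.sum_congr rfl fun i hi => ?_
    congr 1
    refine hg _ _ fun e he0 hne => ?_
    rw [hσ, hσ]
    refine hUV _ ?_
    obtain ⟨h1, h2⟩ := hs i (Finset.mem_range.1 hi)
    simp only [Finset.coe_union, Set.mem_union, Finset.mem_coe, WilsonOddRP.mem_oPosEdges,
      WilsonOddRP.mem_oSharedEdges, WilsonOddRP.IsOPosEdge, WilsonOddRP.IsOSharedEdge,
      Pi.add_apply, Pi.single_eq_same, he0, zero_add]
    rcases h2.lt_or_eq with hlt | heq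
    · exact Or.inl ⟨h1, Nat.lt_succ_iff.1 hlt⟩
    · exact Or.inr ⟨hne, heq⟩
  have hRP := wilsonExpectation_oddReflectionPositive (d := 4) r.ρ hL hL3 r.continuous hβ
    (fun U => (F U : ℂ)) (Complex.measurable_ofReal.comp hFm) ⟨_, hFb⟩ hFdep
  -- back to the reals
  have hprod : ∀ U : GaugeConfig 4 L G,
      conj ((F U.timeReflect : ℝ) : ℂ) * (F U : ℂ) = ((F U.timeReflect * F U : ℝ) : ℂ) :=
    fun U => by rw [Complex.conj_ofReal, Complex.ofReal_mul]
  unfold wilsonExpectation at hRP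
  simp_rw [hprod] at hRP
  rw [integral_complex_ofReal] at hRP
  have hreal := Complex.zero_le_real.1 hRP
  have hrefl : ∀ U : GaugeConfig 4 L G,
      F U.timeReflect = ∑ i ∈ Finset.range n, a i * g (σ (1 - s i) U) := fun U => by
    rw [hF]
    exact Finset.sum_congr rfl fun i _ => by rw [rpHankel_reflect g hg σ hσ (s i) U]
  simp_rw [hrefl, hF] at hreal
  exact hreal.trans_eq (rpHankel_expand _ n a (fun i U => g (σ (1 - s i) U))
    (fun i U => g (σ (s i) U)) (fun i => hσm _) (fun i => hσm _) (fun i U => hgb _)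
    (fun i U => hgb _))

/-- **The four outputs for a bounded measurable `g` of the time-zero spatial links** on the torus
`(2S+1)⁴`: symmetry of the autocovariance, non-negativity of the two Hankel forms, and the
one-step quadratic variation. [folklore] -/
theorem rpHankel_core (r : LatticeRep G) {β : ℝ} (hβ : 0 ≤ β) (S : ℕ)
    {g : GaugeConfig 4 (2 * S + 1) G → ℝ} (hgm : Measurable g) {Cg : ℝ} (hgb : ∀ U, |g U| ≤ Cg)
    (hg : ∀ U V : GaugeConfig 4 (2 * S + 1) G,
      (∀ e : Edge 4 (2 * S + 1), e.1 0 = 0 → e.2 ≠ 0 → U e = V e) → g U = g V)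
    (σ : ZMod (2 * S + 1) → GaugeConfig 4 (2 * S + 1) G → GaugeConfig 4 (2 * S + 1) G)
    (hσ : ∀ z U e, σ z U e = U (e.1 + Pi.single 0 z, e.2))
    (Cor : ℕ → ℝ)
    (hCor : ∀ u : ℕ, Cor u = ∫ U, g U * g (σ (u : ZMod (2 * S + 1)) U) ∂(wilsonMeasure r.ρ β)) :
    (∀ u ≤ 2 * S + 1, Cor u = Cor (2 * S + 1 - u)) ∧
    (∀ a : ℕ → ℝ, 0 ≤ ∑ i ∈ Finset.range (S + 1), ∑ j ∈ Finset.range (S + 1),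
      a i * a j * Cor (i + j)) ∧
    (∀ a : ℕ → ℝ, 0 ≤ ∑ i ∈ Finset.range (S + 1), ∑ j ∈ Finset.range (S + 1),
      a i * a j * Cor (i + j + 1)) ∧
    (∫ U, (g U - g (σ ((1 : ℕ) : ZMod (2 * S + 1)) U)) ^ 2 ∂(wilsonMeasure r.ρ β) =
      2 * Cor 0 - 2 * Cor 1) := by
  haveI := isProbabilityMeasure_wilsonMeasure (d := 4) (L := 2 * S + 1) r.ρ r.continuous β
  have hσm : ∀ x, Measurable fun U : GaugeConfig 4 (2 * S + 1) G => g (σ x U) := fun x =>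
    hgm.comp (rpHankel_measurable_shift σ hσ x)
  have hσ0 : ∀ U, σ 0 U = U := fun U => by
    funext e
    rw [hσ, Pi.single_zero, add_zero]
  have hL0 : ((2 * S + 1 : ℕ) : ZMod (2 * S + 1)) = 0 := ZMod.natCast_self _
  -- symmetry of the autocovariance in `ZMod` form
  have hsymm : ∀ z : ZMod (2 * S + 1),
      ∫ U, g U * g (σ (-z) U) ∂(wilsonMeasure r.ρ β) =
        ∫ U, g U * g (σ z U) ∂(wilsonMeasure r.ρ β) := by
    intro z
    have h := rpHankel_pair r.ρ β σ hσ g z 0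
    simp only [hσ0, zero_sub] at h
    rw [← h]
    exact integral_congr_ae (ae_of_all _ fun U => mul_comm _ _)
  have hCor0 : Cor 0 = ∫ U, g U * g U ∂(wilsonMeasure r.ρ β) := by
    rw [hCor, Nat.cast_zero]
    simp_rw [hσ0]
  have hG0 : 0 ≤ Cor 0 := hCor0 ▸ integral_nonneg fun U => mul_self_nonneg _
  have hi : ∀ u ≤ 2 * S + 1, Cor u = Cor (2 * S + 1 - u) := by
    intro u hu
    have hcast : ((2 * S + 1 - u : ℕ) : ZMod (2 * S + 1)) = -(u : ZMod (2 * S + 1)) := by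
      rw [Nat.cast_sub hu, hL0, zero_sub]
    rw [hCor, hCor, hcast, hsymm]
  refine ⟨hi, fun a => ?_, fun a => ?_, ?_⟩
  · -- first Hankel form
    rcases Nat.eq_zero_or_pos S with hS | hS
    · subst hS
      simp only [zero_add, Finset.range_one, Finset.sum_singleton, add_zero]
      exact mul_nonneg (mul_self_nonneg _) hG0
    · have hL : Odd (2 * S + 1) := odd_two_mul_add_one S
      have hL3 : 3 ≤ 2 * S + 1 := by omega
      have hs : ∀ i < S + 1, 1 ≤ (((S + 1 - i : ℕ) : ZMod (2 * S + 1))).val ∧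
          (((S + 1 - i : ℕ) : ZMod (2 * S + 1))).val ≤ (2 * S + 1) / 2 + 1 := by
        intro i hi
        rw [ZMod.val_natCast, Nat.mod_eq_of_lt (by omega)]
        omega
      have key := rpHankel_rp r hβ hL hL3 hgm hgb hg σ hσ hs a
      refine key.trans_eq (Finset.sum_congr rfl fun i hi =>
        Finset.sum_congr rfl fun j hj => ?_)
      have hi' : i ≤ S + 1 := (Finset.mem_range.1 hi).le
      have hj' : j ≤ S + 1 := (Finset.mem_range.1 hj).le
      have hij : ((S + 1 - j : ℕ) : ZMod (2 * S + 1)) - (1 - ((S + 1 - i : ℕ) : ZMod (2 * S + 1)))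
          = -((i + j : ℕ) : ZMod (2 * S + 1)) := by
        have h2 : ((S + 1 : ℕ) : ZMod (2 * S + 1)) + ((S + 1 : ℕ) : ZMod (2 * S + 1)) = 1 := by
          rw [← Nat.cast_add, show S + 1 + (S + 1) = (2 * S + 1) + 1 by ring, Nat.cast_add, hL0,
            zero_add, Nat.cast_one]
        rw [Nat.cast_sub hi', Nat.cast_sub hj']
        push_cast at h2 ⊢
        linear_combination h2
      rw [rpHankel_pair r.ρ β σ hσ g, hij, hsymm, hCor]
  · -- second Hankel form
    rcases Nat.eq_zero_or_pos S with hS | hS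
    · subst hS
      simp only [zero_add, Finset.range_one, Finset.sum_singleton]
      rw [hi 1 (by norm_num)]
      exact mul_nonneg (mul_self_nonneg _) hG0
    · have hL : Odd (2 * S + 1) := odd_two_mul_add_one S
      have hL3 : 3 ≤ 2 * S + 1 := by omega
      have hs : ∀ i < S + 1, 1 ≤ (((i + 1 : ℕ) : ZMod (2 * S + 1))).val ∧
          (((i + 1 : ℕ) : ZMod (2 * S + 1))).val ≤ (2 * S + 1) / 2 + 1 := by
        intro i hi
        rw [ZMod.val_natCast, Nat.mod_eq_of_lt (by omega)]
        omega
      have key := rpHankel_rp r hβ hL hL3 hgm hgb hg σ hσ hs a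
      refine key.trans_eq (Finset.sum_congr rfl fun i _ => Finset.sum_congr rfl fun j _ => ?_)
      have hij : ((j + 1 : ℕ) : ZMod (2 * S + 1)) - (1 - ((i + 1 : ℕ) : ZMod (2 * S + 1)))
          = ((i + j + 1 : ℕ) : ZMod (2 * S + 1)) := by
        push_cast
        ring
      rw [rpHankel_pair r.ρ β σ hσ g, hij, hCor]
  · -- one-step quadratic variation
    have h1m := hσm ((1 : ℕ) : ZMod (2 * S + 1))
    have hint_gg : Integrable (fun U => g U * g U) (wilsonMeasure r.ρ β) :=
      rpHankel_integrable_mul hgm hgm hgb hgb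
    have hint_gp : Integrable (fun U => g U * g (σ ((1 : ℕ) : ZMod (2 * S + 1)) U))
        (wilsonMeasure r.ρ β) :=
      rpHankel_integrable_mul hgm h1m hgb fun U => hgb _
    have hint_pp : Integrable
        (fun U => g (σ ((1 : ℕ) : ZMod (2 * S + 1)) U) * g (σ ((1 : ℕ) : ZMod (2 * S + 1)) U))
        (wilsonMeasure r.ρ β) :=
      rpHankel_integrable_mul h1m h1m (fun U => hgb _) fun U => hgb _
    have hexp : ∀ U : GaugeConfig 4 (2 * S + 1) G,
        (g U - g (σ ((1 : ℕ) : ZMod (2 * S + 1)) U)) ^ 2 =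
          g U * g U - 2 * (g U * g (σ ((1 : ℕ) : ZMod (2 * S + 1)) U)) +
            g (σ ((1 : ℕ) : ZMod (2 * S + 1)) U) * g (σ ((1 : ℕ) : ZMod (2 * S + 1)) U) :=
      fun U => by ring
    have hint_d : Integrable
        (fun U => g U * g U - 2 * (g U * g (σ ((1 : ℕ) : ZMod (2 * S + 1)) U)))
        (wilsonMeasure r.ρ β) := hint_gg.sub (hint_gp.const_mul 2)
    simp_rw [hexp]
    rw [integral_add hint_d hint_pp, integral_sub hint_gg (hint_gp.const_mul 2), integral_const_mul,
      rpHankel_integral_shift r.ρ β σ hσ _ (fun U => g U * g U), ← hCor0, ← hCor 1]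
    ring

end Wilson

/-! ### The stub -/

/-- **Stub (measure theory, M).** For `β ≥ 0`, every compact group `G` with lattice representation
`r`, every torus `(2S+1)⁴` and every link-Lipschitz function `f` of the time-zero spatial links,
the time autocovariance `G(u) = E_μ (f - m)(f ∘ τ_u - m)` (`τ_u U (x, j) = U (x + u e₀, j)`,
`m = E_μ f`) is symmetric, `G(u) = G(L - u)` (time-translation invariance,
`wilsonMeasure_map_torusConfigShift`), its two Hankel forms of order `S` are non-negative
(Osterwalder–Seiler positivity for the reflection `t ↦ 1 - t` of the odd torus,
`wilsonExpectation_oddReflectionPositive`, applied to `Σ aᵢ (f ∘ τ_{i+1} - m)` and to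
`Σ aᵢ (f ∘ τ_{S+1-i} - m)`, both functions of the spatial links of the slices `1 ≤ t ≤ S+1`),
and `E_μ (f - f ∘ τ₁)² = 2G(0) - 2G(1)`. (`S = 0`: all four are trivial.) [folklore] -/
theorem stub_rpHankel :
    ∀ (G : Type) [Group G] [TopologicalSpace G] [IsTopologicalGroup G] [CompactSpace G]
      [MeasurableSpace G] [BorelSpace G] (r : LatticeRep G) (β : ℝ), 0 ≤ β → ∀ (S : ℕ),
      let μ := wilsonMeasure (d := 4) (L := 2 * S + 1) r.ρ β
      let fro : Matrix (Fin r.N) (Fin r.N) ℂ → ℝ := fun M => ∑ a, ∑ b, ‖M a b‖ ^ 2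
      let τ : ℕ → GaugeConfig 4 (2 * S + 1) G → GaugeConfig 4 (2 * S + 1) G :=
        fun t U e => U (e.1 + Pi.single 0 ((t : ℕ) : ZMod (2 * S + 1)), e.2)
      ∀ f : GaugeConfig 4 (2 * S + 1) G → ℝ,
        (∀ U V : GaugeConfig 4 (2 * S + 1) G,
          (∀ e : Edge 4 (2 * S + 1), e.1 0 = 0 → e.2 ≠ 0 → U e = V e) → f U = f V) →
        (∃ K : ℝ, ∀ U V : GaugeConfig 4 (2 * S + 1) G,
          |f U - f V| ≤ K * ∑ e, Real.sqrt (fro (r.ρ (U e) - r.ρ (V e)))) →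
        let Gf : ℕ → ℝ := fun u => ∫ U, (f U - ∫ V, f V ∂μ) * (f (τ u U) - ∫ V, f V ∂μ) ∂μ
        (∀ u ≤ 2 * S + 1, Gf u = Gf (2 * S + 1 - u)) ∧
        (∀ a : ℕ → ℝ, 0 ≤ ∑ i ∈ Finset.range (S + 1), ∑ j ∈ Finset.range (S + 1),
          a i * a j * Gf (i + j)) ∧
        (∀ a : ℕ → ℝ, 0 ≤ ∑ i ∈ Finset.range (S + 1), ∑ j ∈ Finset.range (S + 1),
          a i * a j * Gf (i + j + 1)) ∧
        (∫ U, (f U - f (τ 1 U)) ^ 2 ∂μ = 2 * Gf 0 - 2 * Gf 1) := by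
  intro G _ _ _ _ _ _ r β hβ S μ fro τ f hf1 hf2 Gf
  haveI : SecondCountableTopology G :=
    (r.continuous.isClosedEmbedding r.injective).isEmbedding.secondCountableTopology
  have hfc : Continuous f := rpHankel_continuous r (by simpa only [fro] using hf2)
  obtain ⟨Cf, hCf⟩ := rpHankel_bounded hfc
  have hgm : Measurable fun U => f U - ∫ V, f V ∂μ := hfc.measurable.sub_const _
  have hgb : ∀ U, |f U - ∫ V, f V ∂μ| ≤ Cf + |∫ V, f V ∂μ| := fun U =>
    (abs_sub _ _).trans (add_le_add (hCf U) le_rfl)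
  have hg : ∀ U V : GaugeConfig 4 (2 * S + 1) G,
      (∀ e : Edge 4 (2 * S + 1), e.1 0 = 0 → e.2 ≠ 0 → U e = V e) →
        f U - ∫ V, f V ∂μ = f V - ∫ V, f V ∂μ := fun U V h => by rw [hf1 U V h]
  obtain ⟨h1, h2, h3, h4⟩ := rpHankel_core r hβ S hgm hgb hg
    (fun z U e => U (e.1 + Pi.single 0 z, e.2)) (fun _ _ _ => rfl) Gf (fun _ => rfl)
  refine ⟨h1, h2, h3, ?_⟩
  have e4 : ∀ U : GaugeConfig 4 (2 * S + 1) G,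
      f U - f (τ 1 U) = (f U - ∫ V, f V ∂μ) - (f (τ 1 U) - ∫ V, f V ∂μ) := fun U => by ring
  simp_rw [e4]
  exact h4

end Summit.QuantumFields.YangMills.Theorems.BrascampLiebVacuum

end
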